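import Mathlib
import HarnessLib
import HarnessLib.Audit
import Summits.AtomisticToContinuum.Statement

/-!
Route: CompensatedClusterPayload

CLOSED (retired) 2026-08-15T13:41:25Z by operator:999:1257524 — reason: not-a-thesis: assembly does not conclude the sub-problem Statement — note: D-0027 §2.1 audit (human 2026-08-15: routes that do not decide the summit are removed): the assembly concludes `Literature.MathematicalPhysics.KineticTheory.HydrodynamicLimit`, not the sub-problem statement; a NEW conforming route may be opened from the same idea (generated `closes : … → _root_.Hydr. The file is kept as the record of this route; refuted decls are indexed as negative knowledge (`ledger negatives`).

# Route CompensatedClusterPayload — Serre's compensated integrability per momentary cluster gives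
collisional-flux tightness at fixed density

X = X_R ∧ X_C ("it suffices to show"), realising card
serre-compensated-integrability-cluster-payload (spine; an A-PRIORI MODULE plus
its bridge). X_R (CollisionPayloadTight, the card's (R) in tightness form): under the local Gibbs
law and the deterministic hard-sphere
flow at fixed reduced density σ < σ₀, the total collisional payload Σ_(collisions in [0,T]) Σ_i
|v_i(t) − v_i(t⁻)| is O_P((N+1)^(4/3)),
i.e. O(1) momentum exchange per particle per interparticle-crossing time — exactly the extensivity
of the collisional stress that every
flux-level closure needs and that no entropy or virial argument gives on 𝕋³. X_R is obtained as
SerrePeriodicPayload (Serre's torus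
compensated-integrability bound, the imported unproved fact, filed FIRST) + ClusterFourthMoment
(fourth moment of momentary-cluster
sizes per kinetic slab under the non-equilibrium law) via the glue PayloadOfClusters. X_C
(PayloadClosure): given X_R, the shared
mean-square waypoint L2HydroFields follows (weak flux closure); then Chebyshev (L2ToHydroLimit,
shared item 0801).
Lean: `CollisionPayloadTight ∧ (CollisionPayloadTight → L2HydroFields)`

## Assembly
Pure logic (sorry-free `assembly_holds` in the planner's Sketch.lean, axioms
propext/Classical.choice/Quot.sound): PayloadOfClusters turns
SerrePeriodicPayload and ClusterFourthMoment into CollisionPayloadTight; PayloadClosure gives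
L2HydroFields; L2ToHydroLimit gives the
conjunct. The Target follows from the first four antecedents (`target_of` in Sketch.lean).

Rationale: WHY THIS LINE. Serre's Compensated Integrability (Serre2019; graph-supported version with
determinantal masses, Serre2021 §4; torus version Serre2024
Thm 3/11) turns "mass and momentum are conserved and the mass–momentum tensor is positive
semi-definite" into an a-priori bound on how much
momentum N balls can exchange: Σ_kinks (v̄|δv| + |v∧v′|) ≤ c_n N² v̄² in ℝⁿ (Serre2021 Thm 1.1, slab
form in §5) and Σ_coll |[v]| ≤
C_d N² v̄ (1 + v̄T/L) on (0,T)×L𝕋^d under the linear-density hypothesis N a < κ_d L (Serre2024 Thm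
6, (19)–(20)) — worst-case sharp (beams),
hence N^(2/3) too weak for the gas and, at fixed reduced density (N a/L = σN^(2/3)/2), not even
applicable to it. The line applies the torus
theorem where its hypothesis holds for free: to each MOMENTARY CLUSTER (Sinai's Δ-cluster,
Sinai1972, DobrushinSinaiSukhov1989,
GabrielovEtAl2008) of ONE kinetic slab of duration (N+1)^(-1/3), an isolated K-ball periodic motion
with Kε < κ as soon as
K < κ(N+1)^(1/3)/σ, whose payload is then ≤ c(K^(3/2)E_K^(1/2) + τ K E_K): polynomial in K, blind to
gaps, cages and contact angles;
Cauchy–Schwarz over clusters and Markov over the T(N+1)^(1/3) slabs reduce (R) to ONE statistic of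
who-touches-whom in a slab, the
fourth moment Σ_i K_i⁴ = O(N) (fourth, not second, so that giant clusters K ≥ κN^(1/3)/σ, where the
torus hypothesis fails, are excluded
by a union bound). Imported areas: a-priori estimates for divergence-controlled positive tensors
(hyperbolic PDE / Alexandrov–Monge–Ampère
geometry) and dynamical-cluster (percolation-in-time) statistics of gases; no entropy, no closure,
no expansion in σ. None of the seven
open routes (RelEntropyErgodic, VanishingNoise, ChaoticMixing, DenseKineticExpansion,
DissipativeWeakStrong, ImplosionLoophole,
OneParticleInfluence) has an a-priori estimate on collisional transfer; DissipativeWeakStrong's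
informal FluxClosure (0823) presupposes
exactly this tightness. Negatives index empty at filing.

RANKED CRUXES. #2 SerrePeriodicPayload (crux) — SERRE'S PERIODIC PAYLOAD BOUND (imported published
fact, filed FIRST per the plancard rule; card S2's engine): there are universal κ > 0 and c such
that for every K, every diameter ε > 0 with Kε < κ, every hard-sphere trajectory γ of K spheres on
𝕋³ (IsHardSphereTrajectory, torus geometry) and every a ≤ b, the payload Σ_(collision times t ∈
[a,b]) Σ_i ‖v_i(t) − v_i(t⁻)‖ (right-continuous velocities, left limits) is ≤ c (K^(3/2) E^(1/2) +
(b − a) K E), E = configEnergy (γ a) = ½Σ|v_i|². Transcription of Serre2024 Thm 6 / (19)–(20)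
(Σ_coll |[v]| ≲_d N (NE)^(1/2) + N E T/L under N a < θ(d) L) to the unit torus, both kinks of a
collision counted; the ℝ³ analogue is Serre2021 Thm 1.1 (slab form, §5). To be vendored as a
Literature named fact and then consumed as a hypothesis; a Lean proof needs the CI theory
(Serre2019; Serre2024 Thm 3, Thm 11; determinantal masses Serre2021 §4). [difficulty: XL] (why it
might fail: Published theorem; risks are formal: transcription (unit torus vs L𝕋³ constants, factor
2 for kinks, collisions exactly at a or b, K ≤ 1) and whether IsHardSphereTrajectory matches Serre's
genericity (binary, locally finite: it does); proving it in Lean means formalising CI itself.)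
[Serre2024, Serre2021, Serre2019, Serre2022, arXiv:2409.12511]
#3 ClusterFourthMoment (crux) — FOURTH MOMENT OF MOMENTARY CLUSTERS (card S1 folded with its chain
counting into one typed statistic): for all continuous profiles a₀, θ₀ > 0, u₀ there is σ₀ such that
for σ < σ₀ and every T > 0 there is C with: for all N, all flows Φ of N+1 spheres of diameter
σ(N+1)^(-1/3), all kinetic slabs [s, s+τ_N] ⊂ [0,T], τ_N = (N+1)^(-1/3): E_(localGibbsLaw) Σ_i
K_i(s)⁴ ≤ C(N+1), where K_i(s) is the size of the connected component of i in the slab collision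
graph (i ~ j iff i, j are in contact at some t ∈ [s, s+τ_N] along the orbit). Heuristics: mean slab
degree ≈ 4√(πθ)ρσ² ≪ 1 for σ small, so the exploration of a cluster is dominated by a subcritical
branching process and all moments are O(1) per particle; the fourth moment (not the second) is what
excludes giant clusters K ≥ κ(N+1)^(1/3)/σ over T(N+1)^(1/3) slabs by a union bound (Σ_i K_i⁴ ≥ K⁵
on a cluster of size K). [difficulty: open-problem] (why it might fail: Subcritical only while the
local slab degree ≈ 4√(πθ)ρσ² < 1: dynamically formed hot/dense regions, or a pre-shock implosion
(route ImplosionLoophole's DenseExcursion — σ₀ is fixed before T) make the slab graph percolate; one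
giant momentary cluster K ≍ N^a, a > 1/5, already breaks Σ_i K_i⁴ = O(N).) [GabrielovEtAl2008,
Sinai1972, DobrushinSinaiSukhov1989, Alexander1975, Spohn1991]
#4 PayloadClosure (crux) — CLOSURE GIVEN THE A-PRIORI BOUND (the bridge from the module to the
conjunct): CollisionPayloadTight → L2HydroFields, filed SELF-CONTAINED (both Props inlined;
definitionally the same implication) because the gate emits cruxes before supports. With the
collisional momentum/energy transfer tight, the empirical flux measures on [0,T)×𝕋³ are tight; the
intended proof identifies limit points as dissipative measure-valued hs-Euler solutions and closes
by relative-energy weak–strong uniqueness before the first shock (the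
FluxClosure/EntropyAdmissibility/WSU programme of route DissipativeWeakStrong, items 0823–0825), or
by any other closure engine that consumes (R). [deps: CollisionPayloadTight] [difficulty:
open-problem] (why it might fail: It is the closure problem given one a-priori bound: tight
collisional fluxes still allow non-Dirac Young-measure limits (persistent velocity anisotropy,
oscillation/concentration defects), and weak–strong uniqueness needs an entropy inequality that (R)
does not supply.) [BrezinaFeireisl2018, OllaVaradhanYau1993, Spohn1991, arXiv:1503.05246]
#9 CollisionPayloadTight (support) — THE MODULE'S DELIVERABLE (card (R), tightness form; direct
proofs welcome at low priority, otherwise via PayloadOfClusters): for all continuous profiles ∃ σ₀ ∀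
σ < σ₀ ∀ T > 0 ∀ η > 0 ∃ C ∀ N ∀ Φ: localGibbsLaw{ z | C (N+1)^(4/3) < Σ_(collision times t ∈ [0,T]
of the orbit of z) Σ_i ‖v_i(t) − v_i(t⁻)‖ } ≤ η. Scale: ≍ 4√(πθ)σ² collisions per particle per slab
(N+1)^(-1/3), each exchanging O(√θ), over T(N+1)^(1/3) slabs. In probability rather than in mean
because on 𝕋³ at fixed reduced density no deterministic bound makes the payload integrable
(Serre2024's linear-density hypothesis fails for the whole gas). Consumers: FluxClosure tightness
half (0823), MeanCollisionalPressureBound of card apriori-tails-and-rattlers, K-inputs of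
stiff-relaxation-collisional-coercivity. [difficulty: open-problem] [Serre2021, Serre2024,
Spohn1991]
#9 PayloadOfClusters (support) — GLUE (card S3; kind glue of the foreseen split of X_R):
SerrePeriodicPayload → ClusterFourthMoment → CollisionPayloadTight. Proof plan: (i) for P-a.e. z
each connected component A (|A| = K) of the slab graph is isolated during the slab, and its
sub-configuration is a piece of a K-sphere torus trajectory, extendable to a global
IsHardSphereTrajectory for a.e. z (K-particle flows exist: HardSphereFlow.nonempty_torus_holds;
cylinders over Liouville_K-null sets are null; localGibbsLaw ≪ Liouville); (ii) on the event that
all clusters of all slabs [kτ_N,(k+1)τ_N] ⊂ [0,T] have K < κ(N+1)^(1/3)/σ (probability ≥ 1 −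
CTσ⁵κ⁻⁵(N+1)^(-1/3) by the fourth moment, Markov and a union bound) apply the fact cluster-wise:
pay(slab) ≤ c[(Σ_i K_i²)^(1/2)(E_tot)^(1/2) + (κ/σ)E_tot] (Cauchy–Schwarz; clusters of one slab are
particle-disjoint; energy conserved); (iii) E_tot ≤ C₂(N+1) with probability ≥ 1 − η/3 (Gaussian
velocities of the canonical law) and Markov on Σ_k(Σ_i K_i(kτ_N)²)^(1/2), whose mean is ≤
(T(N+1)^(1/3)+1)(C(N+1))^(1/2), give pay(0,T) ≤ C_η(N+1)^(4/3) with probability ≥ 1 − η; small N by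
tightness of each law. [difficulty: L] [Serre2024, Alexander1975, GST2013, CIP1994]
#9 EquilibriumClusterMoment (support) — GLOBAL-EQUILIBRIUM CASE of ClusterFourthMoment (constant
profiles c₀, uc, θc; the canonical law is flow-invariant, HomogeneousInvariance item 3073, so the
bound is uniform over all slabs s ∈ ℝ): ∃ σ₀ ∀ σ < σ₀ ∃ C ∀ N Φ s: E Σ_i K_i(s)⁴ ≤ C(N+1). The
quantitative form of Sinai's cluster dynamics (existence and finiteness of Δ-clusters at low density
for short windows, Sinai1972 and its multidimensional extension reported in
DobrushinSinaiSukhov1989; numerics GabrielovEtAl2008: exponential cluster-size law for Δ below t_c ≈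
0.4ρ⁻¹): Palm/GNZ bounds for the canonical hard-sphere gas plus domination of the slab exploration
by a subcritical branching process with Maxwellian marks. First foothold for provers; the MD check
for refuters; the equilibrium half of card S4 (Serre's printed open problem for Gibbs-typical data
then follows with PayloadOfClusters). [difficulty: L] [Sinai1972, DobrushinSinaiSukhov1989,
GabrielovEtAl2008, Alexander1975]
#9 L2HydroFields (support) — SHARED TYPED WAYPOINT (item stmt-AtomisticToContinuum-0800 verbatim;
target of routes DenseKineticExpansion, DissipativeWeakStrong, OneParticleInfluence): mean-square
convergence of the three empirical fields at every t < T under the local Gibbs law; here the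
codomain of PayloadClosure. [difficulty: open-problem] [Spohn1991, OllaVaradhanYau1993]
#9 L2ToHydroLimit (support) — SHARED (item stmt-AtomisticToContinuum-0801 verbatim): L2HydroFields →
HydrodynamicLimit by Markov/Chebyshev in ℝ≥0∞ (meas_ge_le_lintegral_div) and squeeze. [difficulty:
provable-now] [OllaVaradhanYau1993]

TWO-LAYER PLAN. Foreseen glued splits (k ≤ 3, depth 1), filed only when a crux closes or stalls:
ClusterFourthMoment ⇐ ConditionalSlabRate (card S1: given the
slab past and "j is hit at s′", the expected number of further slab-collisions of j is ≤ Cσ², under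
f_t up to T — needs conditional
expectation w.r.t. the flow filtration) → SubcriticalExploration (rate bound ⇒ fourth moment by
chain counting) → ClusterFourthMoment;
PayloadOfClusters ⇐ ClusterSplicing (momentary cluster = a.s.-extendable K-trajectory piece) →
SlabBookkeeping (Cauchy–Schwarz/Markov) →
PayloadOfClusters; PayloadClosure ⇐ FluxTightness (from CollisionPayloadTight, provable) →
DissipativeMvLimit (0823/0824 typed) →
PayloadClosure (with WSU 0825). EquilibriumClusterMoment is the s-independent special case provers
should take first.

KILL CRITERIA. ClusterFourthMoment refuted AT EVERY SLAB SCALE (giant momentary clusters of size ≥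
(N+1)^(1/5+) with non-vanishing probability before T
under some local Gibbs data for all small σ) closes the route `refuted:ClusterFourthMoment`; refuted
only at τ_N = (N+1)^(-1/3) ⇒ pivot:
restate with slabs λ(N+1)^(-1/3), λ = λ(profiles) small (payload is additive over sub-slabs, the
glue is unchanged). CollisionPayloadTight
refuted directly (payload super-extensive in probability) kills the CI placement outright — close,
and record that collisional stress is
not tight at fixed density (this would also break FluxClosure 0823). A formal counterexample to
SerrePeriodicPayload can only be a
mis-transcription of Serre2024 Thm 6 — restate, do not close. PayloadClosure refuted (¬L2HydroFields
while (R) holds) closes the route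
but leaves the module (CollisionPayloadTight, EquilibriumClusterMoment) as Literature-side facts
wanted by other cards. L2HydroFields
proved elsewhere moots PayloadClosure and the route (superseded).

NOT DECOMPOSED YET. The conditional slab-rate statement (card S1; needs `MeasureTheory.condexp`
w.r.t. the σ-algebras generated by the flow on [s, s′] —
deferred until ClusterFourthMoment is taken); the limit-tensor structure (card S5: torus CI for weak
limits of particle mass–momentum
tensors ⇒ ∫∫(det 𝒯_ac)^(1/3) ≤ C and rank-deficient concentration defects — needs a
`DivFreePSDTensorMeasure` notion, tenure work
attached to DissipativeWeakStrong); velocity tails (T) (card apriori-tails-and-rattlers, not this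
mechanism); the constants κ, c of
Serre2024 on the unit torus; the choice λ of the slab length; the FluxTightness child of
PayloadClosure.

CHEAPEST FALSIFIER. (i) Event-driven MD (kit): N+1 ∈ {10³, 10⁴, 10⁵}, σ ∈ {0.2, 0.4}, θ = 1,
equilibrium and a local-Gibbs shear + compression profile;
per slab τ_N record Σ_i K_i⁴/(N+1) for t ≤ T = 1 and pay(0,T)/(N+1)^(4/3): growth with N of either,
or a power-law slab-cluster tail,
kills ClusterFourthMoment as stated (then try slabs λτ_N). (ii) LOOKUP DONE this session:
GabrielovEtAl2008 (2-D elastic billiard,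
10 ≤ N ≤ 10⁴, densities 10⁻⁷–10⁻¹, read pp. 4–8): Δ-cluster masses follow a tapered law
M^(−β)e^(−M/γ(Δ)), essentially exponential
for windows Δ ≪ t_c ≈ 0.4ρ⁻¹ and a pure power law β ≈ 5/2 only at t_c, maximal cluster ∝ log N below
t_c/3 (their (5),(6),(10)); the
kinetic slab sits at Δ/t_c = O(σ²) — consistent with the crux in equilibrium, says nothing out of
equilibrium. (iii) Paper check of
the transcription of Serre2024 Thm 6 (torus period, kinks vs collisions): only constants move (∃κ ∃c
absorbs them).

NUMBERS. Needed: Σ_(unit time)|δv| = O((N+1)^(4/3)) (collisional pressure O(1): ε_N Σ|δv|/(N+1) per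
unit time ≍ σ³). Known deterministic bounds:
Σ_kinks(v̄|δv| + |v∧v′|) ≤ c_n N² v̄² in ℝⁿ, sharp for beams (Serre2021 Thm 1.1, (4)); Σ_coll|[v]| ≤
C_d N² v̄(1 + v̄T/L) on (0,T)×L𝕋^d iff
N a < κ_d L (Serre2024 Thm 6 (7); (19)–(20): ≲_d N(NE)^(1/2) + NET/L); at fixed reduced density N
a/L = σN^(2/3)/2 → ∞, so only clusters
with K < κ(N+1)^(1/3)/σ qualify. Collision count of an isolated K-cluster ≤ (32K^(3/2))^(K²)
(BuragoFerlegerKononenko1998) — why moments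
need CI. Slab statistics: expected collisions per particle per slab ≈ 4√(πθ)ρσ² (Boltzmann rate ×
τ_N; 0.64 at σ = 0.3, θ = ρ = 1);
GabrielovEtAl2008: t_c ≈ 0.4ρ⁻¹, β ≈ 5/2 at t_c, exponential below. Union bound for giant clusters
needs the p-th moment with p > 3
(T(N+1)^(4/3−(p+1)/3) → 0): p = 4 chosen. Items: 9 (3 cruxes, 5 support, 1 assembly; the optional
Target block was dropped after open — the writer emits it first, so it cannot name later decls; X
stays in the thesis Lean line). Assembly filed as SerrePeriodicPayload ∧ ClusterFourthMoment →
PayloadOfClusters → PayloadClosure → L2ToHydroLimit → HydrodynamicLimit.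

DEFINITION REQUESTS. (1) CITE/FACT wanted (filed after open as `--kind cite`): Literature named fact
`SerrePeriodicPayloadBound` in
Literature/MathematicalPhysics/KineticTheory (or Analysis/FluidPDE next to HardSphereDynamics) with
cite tag Serre2024 Thm 6 — once landed,
downstream items are restated with `(h : Fact) →` and crux 2 becomes that fact. (2) DEFINITION
wanted: `collisionPayload G ε γ a b :=
∑ᶠ t ∈ collisionTimes G ε γ ∩ Icc a b, ∑ i, ‖(γ t i).2 − (Function.leftLim γ t i).2‖` and
`slabClusterSize` (connected component of the
slab contact graph) in Literature/Analysis/FluidPDE, shared with cards apriori-tails-and-rattlers,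
contact-traces-are-bulk,
relay-race-light-cone (today inlined via `let`/finsum in every signature).

Novelty: Searches (2026-08-15): `lit search --source crossref "compensated integrability hard spheres
collisions Serre"` (12: Serre 2019/2021/2022/2024 + survey doi:10.1007/978-3-031-55260-1_4; nothing
cluster-wise or in the mean); `lit search --source crossref "Sinai construction of cluster dynamics
…"` (8: Sinai1972 doi:10.1007/bf01028564, DobrushinSinaiSukhov1989, GabrielovEtAl2008
doi:10.4171/057-1/13 — READ pp. 3–9); `lit vsearch "infinite system splits into finite
non-interacting clusters …" --problem` (10 book hits, none joining clusters to CI); `lit frontier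
AtomisticToContinuum --since 2020` (30 rows, no CI); `lit bridges AtomisticToContinuum --cross any`
(30 rows, no CI); `lit galaxy search "compensated integrability" --star all` (galaxyd saturated, no
rows) and `"cluster dynamics" --star all` (12 rows, noise); openalex/s2/arxiv/zbmath rate-limited or
empty (recorded in NOTES). Card + refuter audit reads: arXiv:2002.09157 §1–5, doi:10.5802/crmath.654
pp. 2, 7–8, 17 (re-read this session).
Nearest prior art found: Serre2024 Thm 6 (doi:10.5802/crmath.654) and Serre2021 Thm 1.1
(doi:10.1007/s00205-021-01610-1) — deterministic worst-case N² payload bounds, the periodic one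
under a linear-density hypothesis that fails for the gas at fixed reduced density, typical-data and
pressure questions printed as open (arXiv:2409.12511); Sinai's cluster dynamics (Sinai1972;
DobrushinSinaiSukhov1989) — existence/finiteness of Δ-clusters in equilibrium, no payload;
GabrielovEtAl2008 — numerics  [refs: 10.1007/978-3-031-55260-1_4, 10.1007/bf01028564, 10.4171/057-1/13, 10.5802/crmath.654, 10.1007/s00205-021-01610-1, 2002.09157, 2409.12511, doi:10.1007/978-3-031-55260-1_4, doi:10.1007/bf01028564, doi:10.4171/057-1/13, doi:10.5802/crmath.654, doi:10.1007/s00205-021-01610-1, Sinai1972, DobrushinSinaiSukhov1989, GabrielovEtAl2008, Serre2024, Serre2021]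

Barriers (technique_class: compensated-integrability, dynamical-cluster-statistics): - technique_class: compensated-integrability, dynamical-cluster-statistics
- Literature.Barriers.AtomisticToContinuum.HighMomentumCutoffBarrier: adjacent, not met by the
module — CI bounds COLLISIONAL transfer through conserved cluster energies (E_C^(1/2), E_C), never
exponential velocity moments; the cubic convective energy current is untouched and stays with card
apriori-tails-and-rattlers / crux LargeVelocityControl; PayloadClosure inherits whatever its closure
engine needs.
- Literature.Barriers.AtomisticToContinuum.BoltzmannHypothesisBarrier: the module (cruxes 2–3,
supports) is outside the class (no entropy method, no classification of stationary states); crux 4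
does not evade it by itself — the bet is DissipativeWeakStrong's weak (measure-valued) closure,
which replaces the Boltzmann hypothesis by weak–strong uniqueness before the shock.
- Literature.Barriers.AtomisticToContinuum.NoDensityExpansionBarrier: not met — nothing is expanded
in σ; CI is non-perturbative and σ small enters only through subcriticality of the slab graph (mean
degree ≈ 4√(πθ)ρσ²).
- Literature.Barriers.AtomisticToContinuum.VelocityReversalBarrier: not met — every statement is in
law / in probability under the local Gibbs law, and the payload and cluster functionals are
invariant under time reversal.
- Literature.Barriers.AtomisticToContinuum.DiluteRegimeBarrier: not met — fixed reduced density
(N+1)ε³ = σ³ throughout, no Boltzmann–Grad limit and no kinetic equation.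
- Literature.Barriers.Atomist

History (route lifecycle, newest last):
- 2026-08-15T11:49:46Z · rev 1: restated PayloadClosure (stmt-AtomisticToContinuum-5186) — materialise PayloadClosure: the gate writer emits cruxes before supports, so the crux cannot name the support decls CollisionPayloadTight / L2HydroFields; resta (planner-plancard-AtomisticToContinuum-Hydrody-4e619619-0)
- 2026-08-15T12:02:03Z · rev 1: dropped Target — drop the optional Target block: the gate writer emits it first, so it can never name the later decls CollisionPayloadTight / PayloadClosure; X = CollisionPayloa (planner-plancard-AtomisticToContinuum-Hydrody-4e619619-0)
- 2026-08-15T12:09:38Z · rev 2: restated Assembly (stmt-AtomisticToContinuum-5190) — materialise the Assembly: item 5190 kept a stale block on the superseded PayloadClosure (5186 → 6664, now in the file); same modus-ponens chain with the two mod (planner-plancard-AtomisticToContinuum-Hydrody-4e619619-0)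
- 2026-08-15T13:41:25Z · CLOSED retired — not-a-thesis: assembly does not conclude the sub-problem Statement (operator:999:1257524)

sub-problem: HydrodynamicLimit · status: closed(retired) · opened planner-plancard-AtomisticToContinuum-Hydrody-4e619619-0 2026-08-15T11:40:18Z · rev 2 · ledger route-AtomisticToContinuum-CompensatedClusterPayload
GENERATED by the gate from the ledger (D-0016/17). Provers cite these decls: `theorem foo : Summit.AtomisticToContinuum.HydrodynamicLimit.Theses.CompensatedClusterPayload.<Decl> := …` in Summits/AtomisticToContinuum/HydrodynamicLimit/Theorems/<Name>.lean.
-/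

namespace Summit.AtomisticToContinuum.HydrodynamicLimit.Theses.CompensatedClusterPayload

open scoped BigOperators Topology Manifold Classical MeasureTheory ProbabilityTheory Matrix InnerProductSpace ComplexConjugate ContinuousMap
open Filter Set Function TopologicalSpace MeasureTheory

attribute [summit_statement] _root_.HydrodynamicLimit

/-- item stmt-AtomisticToContinuum-5184 · crux · rank 2 · closed · moot by None · by planner
why it might fail: Published theorem; risks are formal: transcription (unit torus vs L𝕋³ constants, factor 2 for kinks, collisions exactly at a or b, K ≤ 1) and whether IsHardSphereTrajectory matches Serre's genericity (binary, locally finite: it does); proving it in Lean means formalising CI itself.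
sources: Serre2024, Serre2021, Serre2019, Serre2022, arXiv:2409.12511
[crux] SERRE'S PERIODIC PAYLOAD BOUND (imported published fact, filed FIRST per the plancard rule;
card S2's engine): there are universal κ > 0 and c such that for every K, every diameter ε > 0 with
Kε < κ, every hard-sphere trajectory γ of K spheres on 𝕋³ (IsHardSphereTrajectory, torus geometry)
and every a ≤ b, the payload Σ_(collision times t ∈ [a,b]) Σ_i ‖v_i(t) − v_i(t⁻)‖ (right-continuous
velocities, left limits) is ≤ c (K^(3/2) E^(1/2) + (b − a) K E), E = configEnergy (γ a) = ½Σ|v_i|².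
Transcription of Serre2024 Thm 6 / (19)–(20) (Σ_coll |[v]| ≲_d N (NE)^(1/2) + N E T/L under N a <
θ(d) L) to the unit torus, both kinks of a collision counted; the ℝ³ analogue is Serre2021 Thm 1.1
(slab form, §5). To be vendored as a Literature named fact and then consumed as a hypothesis; a Lean
proof needs the CI theory (Serre2019; Serre2024 Thm 3, Thm 11; determinantal masses Serre2021 §4).
[difficulty: XL] -/
@[route_item "route-AtomisticToContinuum-CompensatedClusterPayload"]
def SerrePeriodicPayload : Prop :=
  ∃ κ : ℝ, 0 < κ ∧ ∃ c : ℝ, ∀ (K : ℕ) (ε : ℝ), 0 < ε → (K : ℝ) * ε < κ → ∀ γ : ℝ → Literature.Analysis.FluidPDE.Config K (Fin 3) Literature.MathematicalPhysics.KineticTheory.T3, Literature.Analysis.FluidPDE.IsHardSphereTrajectory (Literature.Analysis.FluidPDE.Torus.geometry (Fin 3)) ε K γ → ∀ a b : ℝ, a ≤ b → (∑ᶠ t ∈ Literature.Analysis.FluidPDE.collisionTimes (Literature.Analysis.FluidPDE.Torus.geometry (Fin 3)) ε γ ∩ Set.Icc a b, ∑ i : Fin K, ‖(γ t i).2 - (Function.leftLim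 γ t i).2‖) ≤ c * ((K : ℝ) ^ ((3 : ℝ) / 2) * Real.sqrt (Literature.Analysis.FluidPDE.configEnergy (γ a)) + (b - a) * (K : ℝ) * Literature.Analysis.FluidPDE.configEnergy (γ a))

/-- item stmt-AtomisticToContinuum-5185 · crux · rank 3 · closed · moot by None · by planner
why it might fail: Subcritical only while the local slab degree ≈ 4√(πθ)ρσ² < 1: dynamically formed hot/dense regions, or a pre-shock implosion (route ImplosionLoophole's DenseExcursion — σ₀ is fixed before T) make the slab graph percolate; one giant momentary cluster K ≍ N^a, a > 1/5, already breaks Σ_i K_i⁴ = O(N).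
sources: GabrielovEtAl2008, Sinai1972, DobrushinSinaiSukhov1989, Alexander1975, Spohn1991
[crux] FOURTH MOMENT OF MOMENTARY CLUSTERS (card S1 folded with its chain counting into one typed
statistic): for all continuous profiles a₀, θ₀ > 0, u₀ there is σ₀ such that for σ < σ₀ and every T
> 0 there is C with: for all N, all flows Φ of N+1 spheres of diameter σ(N+1)^(-1/3), all kinetic
slabs [s, s+τ_N] ⊂ [0,T], τ_N = (N+1)^(-1/3): E_(localGibbsLaw) Σ_i K_i(s)⁴ ≤ C(N+1), where K_i(s)
is the size of the connected component of i in the slab collision graph (i ~ j iff i, j are in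
contact at some t ∈ [s, s+τ_N] along the orbit). Heuristics: mean slab degree ≈ 4√(πθ)ρσ² ≪ 1 for σ
small, so the exploration of a cluster is dominated by a subcritical branching process and all
moments are O(1) per particle; the fourth moment (not the second) is what excludes giant clusters K
≥ κ(N+1)^(1/3)/σ over T(N+1)^(1/3) slabs by a union bound (Σ_i K_i⁴ ≥ K⁵ on a cluster of size K).
[difficulty: open-problem] -/
@[route_item "route-AtomisticToContinuum-CompensatedClusterPayload"]
def ClusterFourthMoment : Prop :=
  ∀ (a₀ θ₀ : Literature.MathematicalPhysics.KineticTheory.T3 → ℝ) (u₀ : Literature.MathematicalPhysics.KineticTheory.T3 → Literature.MathematicalPhysics.KineticTheory.V3), Continuous a₀ → Continuous θ₀ → Continuous u₀ → (∀ x, 0 < a₀ x) → (∀ x, 0 < θ₀ x) → ∃ σ₀ : ℝ, 0 < σ₀ ∧ ∀ σ : ℝ, 0 < σ → σ < σ₀ → ∀ T : ℝ, 0 < T → ∃ C : ℝ, 0 < C ∧ ∀ (N : ℕ) (Φ : Literature.Analysis.FluidPDE.HardSphereFlow (Literature.Analysis.FluidPDE.Torus.geometry (Fin 3)) (Literature.MathematicalPhysics.KineticTheory.hsDiameter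 σ N) (N + 1)) (s : ℝ), 0 ≤ s → s + ((N + 1 : ℕ) : ℝ) ^ (-(1 / 3 : ℝ)) ≤ T → let K : Literature.Analysis.FluidPDE.Config (N + 1) (Fin 3) Literature.MathematicalPhysics.KineticTheory.T3 → Fin (N + 1) → ℕ := fun z i => Nat.card {j : Fin (N + 1) // (SimpleGraph.fromRel fun i' j' : Fin (N + 1) => ∃ t ∈ Set.Icc s (s + ((N + 1 : ℕ) : ℝ) ^ (-(1 / 3 : ℝ))), Φ.flow t z ∈ Literature.Analysis.FluidPDE.contactSet (Literature.Analysis.FluidPDE.Torus.geometry (Fin 3)) (N + 1) (Literature.MathematicalPhysics.KineticTheory.hsDiameter σ N) i' j').Reachable i j}; ∫⁻ z, ((∑ i : Fin (N + 1), K z i ^ 4 : ℕ) : ENNReal) ∂(Literature.MathematicalPhysics.KineticTheory.localGibbsLaw σ a₀ u₀ θ₀ N Φ) ≤ ENNReal.ofReal (C * (N + 1))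

-- earlier PayloadClosure (stmt-AtomisticToContinuum-5186, replaced 2026-08-15T11:49:46Z -> stmt-AtomisticToContinuum-6664): retired by None — CollisionPayloadTight → L2HydroFields
/-- item stmt-AtomisticToContinuum-6664 · crux · rank 4 · closed · moot by None · by planner
why it might fail: It is the closure problem given one a-priori bound: tight collisional fluxes still allow non-Dirac Young-measure limits (persistent velocity anisotropy, oscillation/concentration defects), and weak–strong uniqueness needs an entropy inequality that (R) does not supply.
sources: BrezinaFeireisl2018, OllaVaradhanYau1993, Spohn1991, arXiv:1503.05246
[crux] CLOSURE GIVEN THE A-PRIORI BOUND (the bridge from the module to the conjunct):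
CollisionPayloadTight → L2HydroFields. With the collisional momentum/energy transfer tight, the
empirical flux measures on [0,T)×𝕋³ are tight; the intended proof identifies limit points as
dissipative measure-valued hs-Euler solutions and closes by relative-energy weak–strong uniqueness
before the first shock (the FluxClosure/EntropyAdmissibility/WSU programme of route
DissipativeWeakStrong, items 0823–0825), or by any other closure engine that consumes (R). [deps:
CollisionPayloadTight] [difficulty: open-problem] -/
@[route_item "route-AtomisticToContinuum-CompensatedClusterPayload"]
def PayloadClosure : Prop :=
  (∀ (a₀ θ₀ : Literature.MathematicalPhysics.KineticTheory.T3 → ℝ) (u₀ : Literature.MathematicalPhysics.KineticTheory.T3 → Literature.MathematicalPhysics.KineticTheory.V3), Continuous a₀ → Continuous θ₀ → Continuous u₀ → (∀ x, 0 < a₀ x) → (∀ x, 0 < θ₀ x) → ∃ σ₀ : ℝ, 0 < σ₀ ∧ ∀ σ : ℝ, 0 < σ → σ < σ₀ → ∀ T : ℝ, 0 < T → ∀ η : ℝ, 0 < η → ∃ C : ℝ, ∀ (N : ℕ) (Φ : Literature.Analysis.FluidPDE.HardSphereFlow (Literature.Analysis.FluidPDE.Torus.geometry (Fin 3)) (Literature.MathematicalPhysics.KineticTheory.hsDiameter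 σ N) (N + 1)), Literature.MathematicalPhysics.KineticTheory.localGibbsLaw σ a₀ u₀ θ₀ N Φ {z | C * ((N + 1 : ℕ) : ℝ) ^ ((4 : ℝ) / 3) < ∑ᶠ t ∈ Literature.Analysis.FluidPDE.collisionTimes (Literature.Analysis.FluidPDE.Torus.geometry (Fin 3)) (Literature.MathematicalPhysics.KineticTheory.hsDiameter σ N) (fun t' => Φ.flow t' z) ∩ Set.Icc 0 T, ∑ i : Fin (N + 1), ‖(Φ.flow t z i).2 - (Function.leftLim (fun t' => Φ.flow t' z) t i).2‖} ≤ ENNReal.ofReal η) → (∀ (a₀ θ₀ : Literature.MathematicalPhysics.KineticTheory.T3 → ℝ) (u₀ : Literature.MathematicalPhysics.KineticTheory.T3 → Literature.MathematicalPhysics.KineticTheory.V3), Continuous a₀ → Continuous θ₀ → Continuous u₀ → (∀ x, 0 < a₀ x) → (∀ x, 0 < θ₀ x) → ∃ σ₀ : ℝ, 0 < σ₀ ∧ ∀ σ : ℝ, 0 < σ → σ < σ₀ → ∀ (T : ℝ) (ρ θ : ℝ → Literature.MathematicalPhysics.KineticTheory.T3 → ℝ) (u : ℝ → Literature.MathematicalPhysics.KineticTheory.T3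 → Literature.MathematicalPhysics.KineticTheory.V3), Literature.MathematicalPhysics.KineticTheory.IsHardSphereEulerSolution σ T ρ u θ → ∀ Φ : (N : ℕ) → Literature.Analysis.FluidPDE.HardSphereFlow (Literature.Analysis.FluidPDE.Torus.geometry (Fin 3)) (Literature.MathematicalPhysics.KineticTheory.hsDiameter σ N) (N + 1), Literature.MathematicalPhysics.KineticTheory.TendstoHydroFieldsAt (fun N => Literature.MathematicalPhysics.KineticTheory.localGibbsLaw σ a₀ u₀ θ₀ N (Φ N)) Φ ρ u θ 0 → ∀ t ∈ Set.Ico 0 T, ∀ χ : Literature.MathematicalPhysics.KineticTheory.T3 → ℝ, Continuous χ → Filter.Tendsto (fun N : ℕ => ∫⁻ z, ENNReal.ofReal (|Literature.MathematicalPhysics.KineticTheory.empiricalDensityField ((Φ N).flow t z) χ - ∫ x, χ x * ρ t x| ^ 2) ∂(Literature.MathematicalPhysics.KineticTheory.localGibbsLaw σ a₀ u₀ θ₀ N (Φ N))) Filter.atTop (nhds 0) ∧ Filter.Tendsto (fun N : ℕ => ∫⁻ z, ENNReal.ofReal (‖Literature.MathematicalPhysics.KineticTheory.empiricalMomentumField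 ((Φ N).flow t z) χ - ∫ x, (χ x * ρ t x) • u t x‖ ^ 2) ∂(Literature.MathematicalPhysics.KineticTheory.localGibbsLaw σ a₀ u₀ θ₀ N (Φ N))) Filter.atTop (nhds 0) ∧ Filter.Tendsto (fun N : ℕ => ∫⁻ z, ENNReal.ofReal (|Literature.MathematicalPhysics.KineticTheory.empiricalEnergyField ((Φ N).flow t z) χ - ∫ x, χ x * Literature.MathematicalPhysics.KineticTheory.totalEnergyDensity (ρ t x) (u t x) (θ t x)| ^ 2) ∂(Literature.MathematicalPhysics.KineticTheory.localGibbsLaw σ a₀ u₀ θ₀ N (Φ N))) Filter.atTop (nhds 0))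

/-- item stmt-AtomisticToContinuum-0800 · support · rank 9 · closed · moot by None · by planner
sources: Spohn1991, OllaVaradhanYau1993
[target] Mean-square hydrodynamic limit (typed shadow of one- and two-point cumulant control): for
all continuous profiles ∃ σ₀ ∀ σ<σ₀ ∀ classical hs-Euler solutions on [0,T) ∀ flows, if the local
Gibbs fields converge at t = 0 then for every t < T and continuous χ the lower integrals ∫⁻ |density
field(Φ_t z; χ) − ∫χρ_t|², ∫⁻ ‖momentum field − ∫χρ_t u_t‖², ∫⁻ |energy field − ∫χE_t|² against
localGibbsLaw σ a₀ u₀ θ₀ N tend to 0 in ℝ≥0∞ (lintegral: no Bochner junk). Stronger than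
TendstoHydroFieldsAt (adds uniform integrability); delivered by 1-marginal → local Maxwellian in
(1+|v|²)-weighted L¹ and 2-marginal → product. -/
@[route_item "route-AtomisticToContinuum-CompensatedClusterPayload"]
def L2HydroFields : Prop :=
  ∀ (a₀ θ₀ : Literature.MathematicalPhysics.KineticTheory.T3 → ℝ) (u₀ : Literature.MathematicalPhysics.KineticTheory.T3 → Literature.MathematicalPhysics.KineticTheory.V3), Continuous a₀ → Continuous θ₀ → Continuous u₀ → (∀ x, 0 < a₀ x) → (∀ x, 0 < θ₀ x) → ∃ σ₀ : ℝ, 0 < σ₀ ∧ ∀ σ : ℝ, 0 < σ → σ < σ₀ → ∀ (T : ℝ) (ρ θ : ℝ → Literature.MathematicalPhysics.KineticTheory.T3 → ℝ) (u : ℝ → Literature.MathematicalPhysics.KineticTheory.T3 → Literature.MathematicalPhysics.KineticTheory.V3), Literature.MathematicalPhysics.KineticTheory.IsHardSphereEulerSolution σ T ρ u θ → ∀ Φ : (N : ℕ) → Literature.Analysis.FluidPDE.HardSphereFlow (Literature.Analysis.FluidPDE.Torus.geometry (Fin 3)) (Literature.MathematicalPhysics.KineticTheory.hsDiameter σ N)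 (N + 1), Literature.MathematicalPhysics.KineticTheory.TendstoHydroFieldsAt (fun N => Literature.MathematicalPhysics.KineticTheory.localGibbsLaw σ a₀ u₀ θ₀ N (Φ N)) Φ ρ u θ 0 → ∀ t ∈ Set.Ico 0 T, ∀ χ : Literature.MathematicalPhysics.KineticTheory.T3 → ℝ, Continuous χ → Filter.Tendsto (fun N : ℕ => ∫⁻ z, ENNReal.ofReal (|Literature.MathematicalPhysics.KineticTheory.empiricalDensityField ((Φ N).flow t z) χ - ∫ x, χ x * ρ t x| ^ 2) ∂(Literature.MathematicalPhysics.KineticTheory.localGibbsLaw σ a₀ u₀ θ₀ N (Φ N))) Filter.atTop (nhds 0) ∧ Filter.Tendsto (fun N : ℕ => ∫⁻ z, ENNReal.ofReal (‖Literature.MathematicalPhysics.KineticTheory.empiricalMomentumField ((Φ N).flow t z) χ - ∫ x, (χ x * ρ t x) • u t x‖ ^ 2) ∂(Literature.MathematicalPhysics.KineticTheory.localGibbsLaw σ a₀ u₀ θ₀ N (Φ N))) Filter.atTop (nhds 0) ∧ Filter.Tendsto (fun N : ℕ => ∫⁻ z, ENNReal.ofReal (|Literature.MathematicalPhysics.KineticTheory.empiricalEnergyField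 ((Φ N).flow t z) χ - ∫ x, χ x * Literature.MathematicalPhysics.KineticTheory.totalEnergyDensity (ρ t x) (u t x) (θ t x)| ^ 2) ∂(Literature.MathematicalPhysics.KineticTheory.localGibbsLaw σ a₀ u₀ θ₀ N (Φ N))) Filter.atTop (nhds 0)

/-- item stmt-AtomisticToContinuum-0801 · support · rank 9 · closed · moot by None · by planner
sources: OllaVaradhanYau1993
[assembly] L2HydroFields → HydrodynamicLimit: Markov/Chebyshev in ℝ≥0∞
(MeasureTheory.meas_ge_le_lintegral_div or mul_meas_ge_le_lintegral): P{δ < |F|} ≤ δ⁻² ∫⁻ ofReal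
|F|², measurability of z ↦ field((Φ N).flow t z) from measurable_flow and continuity of χ (or use
the outer-measure form), then squeeze. -/
@[route_item "route-AtomisticToContinuum-CompensatedClusterPayload"]
def L2ToHydroLimit : Prop :=
  L2HydroFields → Literature.MathematicalPhysics.KineticTheory.HydrodynamicLimit

/-- item stmt-AtomisticToContinuum-5187 · support · rank 9 · closed · moot by None · by planner
sources: Serre2021, Serre2024, Spohn1991
[support] THE MODULE'S DELIVERABLE (card (R), tightness form; direct proofs welcome at low priority,
otherwise via PayloadOfClusters): for all continuous profiles ∃ σ₀ ∀ σ < σ₀ ∀ T > 0 ∀ η > 0 ∃ C ∀ N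
∀ Φ: localGibbsLaw{ z | C (N+1)^(4/3) < Σ_(collision times t ∈ [0,T] of the orbit of z) Σ_i ‖v_i(t)
− v_i(t⁻)‖ } ≤ η. Scale: ≍ 4√(πθ)σ² collisions per particle per slab (N+1)^(-1/3), each exchanging
O(√θ), over T(N+1)^(1/3) slabs. In probability rather than in mean because on 𝕋³ at fixed reduced
density no deterministic bound makes the payload integrable (Serre2024's linear-density hypothesis
fails for the whole gas). Consumers: FluxClosure tightness half (0823), MeanCollisionalPressureBound
of card apriori-tails-and-rattlers, K-inputs of stiff-relaxation-collisional-coercivity.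
[difficulty: open-problem] -/
@[route_item "route-AtomisticToContinuum-CompensatedClusterPayload"]
def CollisionPayloadTight : Prop :=
  ∀ (a₀ θ₀ : Literature.MathematicalPhysics.KineticTheory.T3 → ℝ) (u₀ : Literature.MathematicalPhysics.KineticTheory.T3 → Literature.MathematicalPhysics.KineticTheory.V3), Continuous a₀ → Continuous θ₀ → Continuous u₀ → (∀ x, 0 < a₀ x) → (∀ x, 0 < θ₀ x) → ∃ σ₀ : ℝ, 0 < σ₀ ∧ ∀ σ : ℝ, 0 < σ → σ < σ₀ → ∀ T : ℝ, 0 < T → ∀ η : ℝ, 0 < η → ∃ C : ℝ, ∀ (N : ℕ) (Φ : Literature.Analysis.FluidPDE.HardSphereFlow (Literature.Analysis.FluidPDE.Torus.geometry (Fin 3)) (Literature.MathematicalPhysics.KineticTheory.hsDiameter σ N) (N + 1)), Literature.MathematicalPhysics.KineticTheory.localGibbsLaw σ a₀ u₀ θ₀ N Φ {z | C * ((N + 1 : ℕ) : ℝ) ^ ((4 : ℝ) / 3) < ∑ᶠ t ∈ Literature.Analysis.FluidPDE.collisionTimes (Literature.Analysis.FluidPDE.Torus.geometry (Fin 3)) (Literature.MathematicalPhysics.KineticTheory.hsDiameter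 σ N) (fun t' => Φ.flow t' z) ∩ Set.Icc 0 T, ∑ i : Fin (N + 1), ‖(Φ.flow t z i).2 - (Function.leftLim (fun t' => Φ.flow t' z) t i).2‖} ≤ ENNReal.ofReal η

/-- item stmt-AtomisticToContinuum-5188 · support · rank 9 · closed · moot by None · by planner
sources: Serre2024, Alexander1975, GST2013, CIP1994
[support] GLUE (card S3; kind glue of the foreseen split of X_R): SerrePeriodicPayload →
ClusterFourthMoment → CollisionPayloadTight. Proof plan: (i) for P-a.e. z each connected component A
(|A| = K) of the slab graph is isolated during the slab, and its sub-configuration is a piece of a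
K-sphere torus trajectory, extendable to a global IsHardSphereTrajectory for a.e. z (K-particle
flows exist: HardSphereFlow.nonempty_torus_holds; cylinders over Liouville_K-null sets are null;
localGibbsLaw ≪ Liouville); (ii) on the event that all clusters of all slabs [kτ_N,(k+1)τ_N] ⊂ [0,T]
have K < κ(N+1)^(1/3)/σ (probability ≥ 1 − CTσ⁵κ⁻⁵(N+1)^(-1/3) by the fourth moment, Markov and a
union bound) apply the fact cluster-wise: pay(slab) ≤ c[(Σ_i K_i²)^(1/2)(E_tot)^(1/2) + (κ/σ)E_tot]
(Cauchy–Schwarz; clusters of one slab are particle-disjoint; energy conserved); (iii) E_tot ≤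
C₂(N+1) with probability ≥ 1 − η/3 (Gaussian velocities of the canonical law) and Markov on Σ_k(Σ_i
K_i(kτ_N)²)^(1/2), whose mean is ≤ (T(N+1)^(1/3)+1)(C(N+1))^(1/2), give pay(0,T) ≤ C_η(N+1)^(4/3)
with probability ≥ 1 − η; small N by tightness of each law. [difficulty: L] -/
@[route_item "route-AtomisticToContinuum-CompensatedClusterPayload"]
def PayloadOfClusters : Prop :=
  SerrePeriodicPayload → ClusterFourthMoment → CollisionPayloadTight

/-- item stmt-AtomisticToContinuum-5189 · support · rank 9 · closed · moot by None · by planner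
sources: Sinai1972, DobrushinSinaiSukhov1989, GabrielovEtAl2008, Alexander1975
[support] GLOBAL-EQUILIBRIUM CASE of ClusterFourthMoment (constant profiles c₀, uc, θc; the
canonical law is flow-invariant, HomogeneousInvariance item 3073, so the bound is uniform over all
slabs s ∈ ℝ): ∃ σ₀ ∀ σ < σ₀ ∃ C ∀ N Φ s: E Σ_i K_i(s)⁴ ≤ C(N+1). The quantitative form of Sinai's
cluster dynamics (existence and finiteness of Δ-clusters at low density for short windows, Sinai1972
and its multidimensional extension reported in DobrushinSinaiSukhov1989; numerics GabrielovEtAl2008: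
exponential cluster-size law for Δ below t_c ≈ 0.4ρ⁻¹): Palm/GNZ bounds for the canonical
hard-sphere gas plus domination of the slab exploration by a subcritical branching process with
Maxwellian marks. First foothold for provers; the MD check for refuters; the equilibrium half of
card S4 (Serre's printed open problem for Gibbs-typical data then follows with PayloadOfClusters).
[difficulty: L] -/
@[route_item "route-AtomisticToContinuum-CompensatedClusterPayload"]
def EquilibriumClusterMoment : Prop :=
  ∀ (c₀ θc : ℝ) (uc : Literature.MathematicalPhysics.KineticTheory.V3), 0 < c₀ → 0 < θc → ∃ σ₀ : ℝ, 0 < σ₀ ∧ ∀ σ : ℝ, 0 < σ → σ < σ₀ → ∃ C : ℝ, 0 < C ∧ ∀ (N : ℕ) (Φ : Literature.Analysis.FluidPDE.HardSphereFlow (Literature.Analysis.FluidPDE.Torus.geometry (Fin 3)) (Literature.MathematicalPhysics.KineticTheory.hsDiameter σ N) (N + 1)) (s : ℝ), let K : Literature.Analysis.FluidPDE.Config (N + 1) (Fin 3) Literature.MathematicalPhysics.KineticTheory.T3 → Fin (N + 1) → ℕ := fun z i => Nat.card {j : Fin (N + 1) // (SimpleGraph.fromRel fun i' j' : Fin (N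 + 1) => ∃ t ∈ Set.Icc s (s + ((N + 1 : ℕ) : ℝ) ^ (-(1 / 3 : ℝ))), Φ.flow t z ∈ Literature.Analysis.FluidPDE.contactSet (Literature.Analysis.FluidPDE.Torus.geometry (Fin 3)) (N + 1) (Literature.MathematicalPhysics.KineticTheory.hsDiameter σ N) i' j').Reachable i j}; ∫⁻ z, ((∑ i : Fin (N + 1), K z i ^ 4 : ℕ) : ENNReal) ∂(Literature.MathematicalPhysics.KineticTheory.localGibbsLaw σ (fun _ => c₀) (fun _ => uc) (fun _ => θc) N Φ) ≤ ENNReal.ofReal (C * (N + 1))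

-- earlier Assembly (stmt-AtomisticToContinuum-5190, replaced 2026-08-15T12:09:38Z -> stmt-AtomisticToContinuum-7441): retired by None — SerrePeriodicPayload → ClusterFourthMoment → PayloadOfClusters → PayloadClosure → L2ToHydroLimit → Literature.MathematicalPhysics.KineticTheory.HydrodynamicLimit
/-- item stmt-AtomisticToContinuum-7441 · assembly · rank 1 · closed · moot by None · by planner
sources: Serre2021, Spohn1991, OllaVaradhanYau1993
[assembly] SerrePeriodicPayload → ClusterFourthMoment → PayloadOfClusters → PayloadClosure →
L2ToHydroLimit → HydrodynamicLimit (modus ponens chain; no physics). -/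
@[route_item "route-AtomisticToContinuum-CompensatedClusterPayload"]
def Assembly : Prop :=
  SerrePeriodicPayload ∧ ClusterFourthMoment → PayloadOfClusters → PayloadClosure → L2ToHydroLimit → Literature.MathematicalPhysics.KineticTheory.HydrodynamicLimit

end Summit.AtomisticToContinuum.HydrodynamicLimit.Theses.CompensatedClusterPayload
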